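import Summits.BirchSwinnertonDyer.BirchSwinnertonDyer.Theorems.ResidualThetaTransportAtTwoArtinDefs
import Literature.NumberTheory.Multiplicative.ArtinPrimitiveRootProgressions
import HarnessLib

/-!
# Route `ResidualThetaTransportAtTwo`, node (G′)_N (item 27436): the registered conjecture `ArtinPrimitiveRootTwoAP` FROM ERH and the
# printed Hooley–Lenstra–Moree theorem (named fact `lenstra1977_exists_prime_two_primitiveRoot_progression_of_ERH`)

Cell `bsd-wall`, extra width seat `bsd-wall-rtt-p3-w5` g0 (2026-08-28). ONE THEOREM; helper `--supports stmt-BirchSwinnertonDyer-20688`; BSD is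
not proved by this. It links width seat w4's `@[conjecture] def ArtinPrimitiveRootTwoAP` (p629022; the hypothesis of both kernel chains
for `Lines/birth-generation.md` §4.2) to the tree's registered open statement `Literature.NumberTheory.LFunctions.ExtendedRiemannHypothesis`
through the Literature named fact «ERH ⟹ Artin primes for `2` in progressions `≡ 3 (mod 8)`» (Lenstra 1977 Thm. (8.3); Moree 1999 Thm. 2 and
Thm. 4). So every closer keyed on `ArtinPrimitiveRootTwoAP` (`…CuspSpanArtinAP`, w4's `…CuspSpanArtin*`) becomes a theorem GRANTED ERH and
that printed theorem. Nothing is asserted: ERH is open; the named fact is Literature debt.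

References: H. W. Lenstra, Invent. Math. 42 (1977) 201–224 [Lenstra1977]; P. Moree, J. Number Theory 78 (1999) 85–98 [Moree1999].
-/

set_option autoImplicit false
set_option linter.dupNamespace false

noncomputable section

namespace Summit.BirchSwinnertonDyer.BirchSwinnertonDyer.Theorems.SignedMuAtTwo

/-- **ERH ⟹ `ArtinPrimitiveRootTwoAP`**, granted the printed Hooley–Lenstra–Moree theorem (the Literature named fact
`lenstra1977_exists_prime_two_primitiveRoot_progression_of_ERH`): a reshuffling of quantifiers and of `q ≡ r [MOD m]` ↔ `q % m = r % m`.
[cite: Lenstra1977, Thm. (8.3)] [cite: Moree1999, Thm. 2 and Thm. 4] -/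
theorem artinPrimitiveRootTwoAP_of_ERH
    (hLM : Literature.NumberTheory.Multiplicative.lenstra1977_exists_prime_two_primitiveRoot_progression_of_ERH)
    (hERH : Literature.NumberTheory.LFunctions.ExtendedRiemannHypothesis) : ArtinPrimitiveRootTwoAP := by
  intro m r hm hr hrm B
  obtain ⟨q, hq, hB, hqr, hroot⟩ := hLM hERH m r B hm hr hrm
  exact ⟨q, hB, hq, hqr, hroot⟩

end Summit.BirchSwinnertonDyer.BirchSwinnertonDyer.Theorems.SignedMuAtTwo

end
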